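/-
Copyright (c) 2026 the pub-hodgecm2 formalisation cell (harness21).  New file, not vendored.
Origin: seat `prover-pub-hodgecm2-rekey-l0-instlevel-a-g1-0` (unit pub-hodgecm2-rekey-l0-instlevel-a-g1), Track T sub-lemma (T1)
of DECISION #19 (A) (pub-hodgecm2/INBOX 2026-08-23): the antilinear involution `F∞ = conj ⊗ id` on the tower, 2026-08-23.
HELD pending orientation adjudication; HC_CM is NOT proved; nothing here is cited, nothing is minted.
-/
import Summits.HodgeConjecture.HodgeCM.Model.TowerFixed
import Literature.AlgebraicGeometry.Motives.HodgeStructure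

/-!
# (T1) The antilinear involution `F∞ = conj ⊗ id` on the tower `H = colim_K H¹(X_K(ℂ); ℂ)`

Every level carrier `H_K ⊆ Π_h ℂ ⊗_ℚ H¹(P_{Γ.conj h}; ℚ)` and every structure map of the tower (`trPull`, `restrictLevel`,
`castLevel`, `translate`, `res`) is the complexification `f ⊗ ℂ` of a `ℚ`-linear map, so the componentwise complex conjugation
`conj ⊗ id` (`Literature.AlgebraicGeometry.Motives.HodgeStructure.conj`, Deligne's real structure) commutes with all of them.
This file builds, Mathlib-only on top of the live tower files:

* `TowerLevel.conjLevel : H_K →ₗ⋆[ℂ] H_K` — componentwise `conj ⊗ id`; an involution; commutes with `res`, `restrictLevel`,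
  `castLevel`, `translate`;
* `TowerCarrier.conjTower : Tower →ₗ⋆[ℂ] Tower` — its direct limit (`Module.DirectLimit.lift` into the scalar-conjugate copy of the
  tower), `conjTower_ofLevel`, an involution (`conjTowerEquiv : Tower ≃ₗ⋆[ℂ] Tower`), `U(V)(𝔸_f)`-EQUIVARIANT (`act_conjTower`,
  `of_smul_conjTower`), hence preserving `fixedBy Γ.K` and `levelImage Γ`;
* `resTotal_conjTower_of_mem_fixedBy` — on `Γ.K`-fixed vectors (the only ones r8 `Thm418Combined` restricts) the identity-component
  restriction intertwines `conjTower` with `conj ⊗ id` on `H¹(P_Γ; ℂ)`.  (Off the fixed vectors `resTotal Γ` is a CHOSEN linear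
  extension, `TowerRes.toLevel`, and no intertwining is claimed.)

These are the sockets `F`, `hF`, `hres` of the antilinear transport frame (T0) (wb-5, `D2Bridge/Thm418CConjTransport`).
-/

noncomputable section

open Function Set
open NumberField
open Literature.AlgebraicGeometry.Motives
open Literature.AlgebraicGeometry.ShimuraVarieties
open Literature.AlgebraicGeometry.HodgeTheory
open Literature.NumberTheory.Automorphic
open Literature.NumberTheory.Automorphic.PicardCM
open Literature.NumberTheory.Transcendental (Arapura2012_Cor_15_4_6)

namespace Summit.HodgeConjecture.CorCM.D2Bridge.TowerConj

open HodgeCM HodgeCM.Model HodgeCM.Model.LevelTranslate HodgeCM.Model.TowerLevel HodgeCM.Model.TowerCarrier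
open HodgeCM.Literature.Theta

/-! ## 0. `conj ⊗ id` commutes with complexified pull-backs: `HodgeCM.Universe.conj_pullC` (`Proofs/Prop22/Basic`). -/

/- Explicit per-declaration binders for the universe records `hHD hI hU h₃ hA` (no section `variable` carrying a named
Prop — coordinator rule (4) of the re-key night). -/
variable {L : CMField} {ι₁ : L →+* ℂ} {V : HermSpace3 L ι₁}

/-! ## 1. Componentwise conjugation on the level carriers `H_K` -/

section Level

/-- `conj ⊗ id` commutes with every rational-translate pull-back `t_γ^*`. -/
theorem conj_trPull (hHD : exists_isReal_hodgeModel) (hI : hodgePQ_independent_of_hodgeModel)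
    (hU : BallQuotientUniformisedDatum) (h₃ : CMAbelianVarietyRealised) (hA : Arapura2012_Cor_15_4_6)
    (γ : ↥(Urat V)) (Δ₁ Δ₂ : Level V) (ht : TransCond (γ : GL (Fin 3) L) Δ₁ Δ₂) (k : ℕ)
    (x : Coh hHD hI hU h₃ Δ₂ k) :
    HodgeStructure.conj (trPull hHD hI hU h₃ hA γ Δ₁ Δ₂ ht k x) =
      trPull hHD hI hU h₃ hA γ Δ₁ Δ₂ ht k (HodgeStructure.conj x) :=
  HodgeStructure.conj_baseChange _ _

variable {Γ : Level V} {hΓ : Γ.BelowConjThree}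

/-- A family of component classes is in `H_K` iff its componentwise conjugate is. -/
theorem conj_mem_towerLevel (hHD : exists_isReal_hodgeModel) (hI : hodgePQ_independent_of_hodgeModel)
    (hU : BallQuotientUniformisedDatum) (h₃ : CMAbelianVarietyRealised) (hA : Arapura2012_Cor_15_4_6)
    {c : Π h : V.adelicFin, W hHD hI hU h₃ Γ hΓ h} (hc : c ∈ towerLevel hHD hI hU h₃ hA Γ hΓ) :
    (fun h ↦ HodgeStructure.conj (c h)) ∈ towerLevel hHD hI hU h₃ hA Γ hΓ :=
  (mem_towerLevel_iff hHD hI hU h₃ hA).mpr fun γ h h' r ↦ by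
    simp only [(mem_towerLevel_iff hHD hI hU h₃ hA).mp hc γ h h' r, conj_trPull]

/-- **`conj ⊗ id` on `H_K`**, componentwise; `ℂ`-antilinear. -/
def conjLevel (hHD : exists_isReal_hodgeModel) (hI : hodgePQ_independent_of_hodgeModel)
    (hU : BallQuotientUniformisedDatum) (h₃ : CMAbelianVarietyRealised) (hA : Arapura2012_Cor_15_4_6)
    (Γ : Level V) (hΓ : Γ.BelowConjThree) : towerLevel hHD hI hU h₃ hA Γ hΓ →ₗ⋆[ℂ] towerLevel hHD hI hU h₃ hA Γ hΓ where
  toFun c := ⟨fun h ↦ HodgeStructure.conj ((c : Π h, W hHD hI hU h₃ Γ hΓ h) h), conj_mem_towerLevel hHD hI hU h₃ hA c.2⟩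
  map_add' c d := by
    ext h
    simp only [Submodule.coe_add, Pi.add_apply, map_add]
  map_smul' a c := by
    ext h
    simp only [Submodule.coe_smul, Pi.smul_apply, HodgeStructure.conj_smul]

/-- `conjLevel` acts componentwise by `conj ⊗ id`. -/
@[simp] theorem conjLevel_apply (hHD : exists_isReal_hodgeModel) (hI : hodgePQ_independent_of_hodgeModel)
    (hU : BallQuotientUniformisedDatum) (h₃ : CMAbelianVarietyRealised) (hA : Arapura2012_Cor_15_4_6)
    (c : towerLevel hHD hI hU h₃ hA Γ hΓ) (h : V.adelicFin) :
    (conjLevel hHD hI hU h₃ hA Γ hΓ c : Π h, W hHD hI hU h₃ Γ hΓ h) h =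
      HodgeStructure.conj ((c : Π h, W hHD hI hU h₃ Γ hΓ h) h) := rfl

/-- `conj ⊗ id` on `H_K` is an involution. -/
@[simp] theorem conjLevel_conjLevel (hHD : exists_isReal_hodgeModel) (hI : hodgePQ_independent_of_hodgeModel)
    (hU : BallQuotientUniformisedDatum) (h₃ : CMAbelianVarietyRealised) (hA : Arapura2012_Cor_15_4_6) (c : towerLevel hHD hI hU h₃ hA Γ hΓ) :
    conjLevel hHD hI hU h₃ hA Γ hΓ (conjLevel hHD hI hU h₃ hA Γ hΓ c) = c := by
  apply Subtype.ext; funext h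
  simp only [conjLevel_apply, HodgeStructure.conj_conj]

/-- **`res ∘ conj = conj ∘ res`** on `H_K`: the identity-component value of the conjugate family is the conjugate class. -/
theorem res_conjLevel (hHD : exists_isReal_hodgeModel) (hI : hodgePQ_independent_of_hodgeModel)
    (hU : BallQuotientUniformisedDatum) (h₃ : CMAbelianVarietyRealised) (hA : Arapura2012_Cor_15_4_6) (c : towerLevel hHD hI hU h₃ hA Γ hΓ) :
    TowerLevel.res hHD hI hU h₃ hA (conjLevel hHD hI hU h₃ hA Γ hΓ c) =
      HodgeStructure.conj (TowerLevel.res hHD hI hU h₃ hA c) := by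
  rw [res_apply, res_apply, conjLevel_apply, conj_trPull]

/-- `conj` commutes with the change of level. -/
theorem restrictLevel_conjLevel (hHD : exists_isReal_hodgeModel) (hI : hodgePQ_independent_of_hodgeModel)
    (hU : BallQuotientUniformisedDatum) (h₃ : CMAbelianVarietyRealised) (hA : Arapura2012_Cor_15_4_6)
    {Γ Γ' : Level V} (hle : Γ' ≤ Γ) (hΓ : Γ.BelowConjThree) (hΓ' : Γ'.BelowConjThree)
    (c : towerLevel hHD hI hU h₃ hA Γ hΓ) :
    restrictLevel hHD hI hU h₃ hA hle hΓ hΓ' (conjLevel hHD hI hU h₃ hA Γ hΓ c) =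
      conjLevel hHD hI hU h₃ hA Γ' hΓ' (restrictLevel hHD hI hU h₃ hA hle hΓ hΓ' c) := by
  apply Subtype.ext; funext h
  simp only [restrictLevel_apply, conjLevel_apply, conj_trPull]

/-- `conj` commutes with crossing an equality of levels. -/
theorem castLevel_conjLevel (hHD : exists_isReal_hodgeModel) (hI : hodgePQ_independent_of_hodgeModel)
    (hU : BallQuotientUniformisedDatum) (h₃ : CMAbelianVarietyRealised) (hA : Arapura2012_Cor_15_4_6)
    {Γ₁ Γ₂ : Level V} (e : Γ₁ = Γ₂) (hΓ₁ : Γ₁.BelowConjThree) (hΓ₂ : Γ₂.BelowConjThree)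
    (c : towerLevel hHD hI hU h₃ hA Γ₁ hΓ₁) :
    castLevel hHD hI hU h₃ hA e hΓ₁ hΓ₂ (conjLevel hHD hI hU h₃ hA Γ₁ hΓ₁ c) =
      conjLevel hHD hI hU h₃ hA Γ₂ hΓ₂ (castLevel hHD hI hU h₃ hA e hΓ₁ hΓ₂ c) :=
  restrictLevel_conjLevel hHD hI hU h₃ hA e.symm.le hΓ₁ hΓ₂ c

/-- `conj` commutes with the re-indexing action `translate g : H_K → H_{gKg⁻¹}`. -/
theorem translate_conjLevel (hHD : exists_isReal_hodgeModel) (hI : hodgePQ_independent_of_hodgeModel)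
    (hU : BallQuotientUniformisedDatum) (h₃ : CMAbelianVarietyRealised) (hA : Arapura2012_Cor_15_4_6)
    (hΓ : Γ.BelowConjThree) (g : V.adelicFin) (c : towerLevel hHD hI hU h₃ hA Γ hΓ) :
    translate hHD hI hU h₃ hA hΓ g (conjLevel hHD hI hU h₃ hA Γ hΓ c) =
      conjLevel hHD hI hU h₃ hA (Γ.conj g hΓ) (hΓ.conj g) (translate hHD hI hU h₃ hA hΓ g c) := by
  apply Subtype.ext; funext h
  simp only [translate_apply, conjLevel_apply, conj_trPull]

end Level

/-! ## 2. The conjugation on the tower (direct limit) -/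

section Tower

/-- The tower with the CONJUGATE `ℂ`-structure `a ⋆ x := conj a • x` (a bookkeeping synonym: a `ℂ`-linear map into it is a
`ℂ`-antilinear map into the tower, which lets `Module.DirectLimit.lift` build the antilinear `conjTower`). -/
def CTower (hHD : exists_isReal_hodgeModel) (hI : hodgePQ_independent_of_hodgeModel)
    (hU : BallQuotientUniformisedDatum) (h₃ : CMAbelianVarietyRealised) (hA : Arapura2012_Cor_15_4_6)
    (V : HermSpace3 L ι₁) : Type := Tower hHD hI hU h₃ hA V

/-- The additive group of the conjugate copy is that of the tower. -/
instance CTower.instAddCommGroup (hHD : exists_isReal_hodgeModel) (hI : hodgePQ_independent_of_hodgeModel)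
    (hU : BallQuotientUniformisedDatum) (h₃ : CMAbelianVarietyRealised) (hA : Arapura2012_Cor_15_4_6) : AddCommGroup (CTower hHD hI hU h₃ hA V) :=
  inferInstanceAs (AddCommGroup (Tower hHD hI hU h₃ hA V))

/-- The conjugate `ℂ`-structure: `a ⋆ x := conj a • x` (`Module.compHom` along `starRingEnd ℂ`). -/
instance CTower.instModule (hHD : exists_isReal_hodgeModel) (hI : hodgePQ_independent_of_hodgeModel)
    (hU : BallQuotientUniformisedDatum) (h₃ : CMAbelianVarietyRealised) (hA : Arapura2012_Cor_15_4_6) : Module ℂ (CTower hHD hI hU h₃ hA V) :=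
  Module.compHom (Tower hHD hI hU h₃ hA V) (starRingEnd ℂ)

/-- The identity `Tower → CTower`. -/
def toC (hHD : exists_isReal_hodgeModel) (hI : hodgePQ_independent_of_hodgeModel)
    (hU : BallQuotientUniformisedDatum) (h₃ : CMAbelianVarietyRealised) (hA : Arapura2012_Cor_15_4_6)
    (x : Tower hHD hI hU h₃ hA V) : CTower hHD hI hU h₃ hA V := x

/-- The identity `CTower → Tower`. -/
def ofC (hHD : exists_isReal_hodgeModel) (hI : hodgePQ_independent_of_hodgeModel)
    (hU : BallQuotientUniformisedDatum) (h₃ : CMAbelianVarietyRealised) (hA : Arapura2012_Cor_15_4_6)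
    (x : CTower hHD hI hU h₃ hA V) : Tower hHD hI hU h₃ hA V := x

/-- `ofC ∘ toC = id`. -/
@[simp] theorem ofC_toC (hHD : exists_isReal_hodgeModel) (hI : hodgePQ_independent_of_hodgeModel)
    (hU : BallQuotientUniformisedDatum) (h₃ : CMAbelianVarietyRealised) (hA : Arapura2012_Cor_15_4_6)
    (x : Tower hHD hI hU h₃ hA V) : ofC hHD hI hU h₃ hA (toC hHD hI hU h₃ hA x) = x := rfl
/-- `toC` is additive. -/
@[simp] theorem toC_add (hHD : exists_isReal_hodgeModel) (hI : hodgePQ_independent_of_hodgeModel)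
    (hU : BallQuotientUniformisedDatum) (h₃ : CMAbelianVarietyRealised) (hA : Arapura2012_Cor_15_4_6) (x y : Tower hHD hI hU h₃ hA V) :
    toC hHD hI hU h₃ hA (x + y) = toC hHD hI hU h₃ hA x + toC hHD hI hU h₃ hA y := rfl
/-- `toC (conj a • x) = a ⋆ toC x`. -/
theorem toC_conj_smul (hHD : exists_isReal_hodgeModel) (hI : hodgePQ_independent_of_hodgeModel)
    (hU : BallQuotientUniformisedDatum) (h₃ : CMAbelianVarietyRealised) (hA : Arapura2012_Cor_15_4_6) (a : ℂ) (x : Tower hHD hI hU h₃ hA V) :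
    toC hHD hI hU h₃ hA (starRingEnd ℂ a • x) = a • toC hHD hI hU h₃ hA x := rfl
/-- `ofC` is additive. -/
@[simp] theorem ofC_add (hHD : exists_isReal_hodgeModel) (hI : hodgePQ_independent_of_hodgeModel)
    (hU : BallQuotientUniformisedDatum) (h₃ : CMAbelianVarietyRealised) (hA : Arapura2012_Cor_15_4_6) (x y : CTower hHD hI hU h₃ hA V) :
    ofC hHD hI hU h₃ hA (x + y) = ofC hHD hI hU h₃ hA x + ofC hHD hI hU h₃ hA y := rfl
/-- `ofC (a ⋆ x) = conj a • ofC x`. -/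
theorem ofC_smul (hHD : exists_isReal_hodgeModel) (hI : hodgePQ_independent_of_hodgeModel)
    (hU : BallQuotientUniformisedDatum) (h₃ : CMAbelianVarietyRealised) (hA : Arapura2012_Cor_15_4_6) (a : ℂ) (x : CTower hHD hI hU h₃ hA V) :
    ofC hHD hI hU h₃ hA (a • x) = starRingEnd ℂ a • ofC hHD hI hU h₃ hA x := rfl

/-- Level `i` of the tower into the conjugate copy: `c ↦ [conj c]`, `ℂ`-linear for the conjugate structure. -/
def conjToC (hHD : exists_isReal_hodgeModel) (hI : hodgePQ_independent_of_hodgeModel)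
    (hU : BallQuotientUniformisedDatum) (h₃ : CMAbelianVarietyRealised) (hA : Arapura2012_Cor_15_4_6)
    (i : TLvl V) : HK hHD hI hU h₃ hA V i →ₗ[ℂ] CTower hHD hI hU h₃ hA V where
  toFun c := toC hHD hI hU h₃ hA (ofLevel hHD hI hU h₃ hA i.1 i.2 (conjLevel hHD hI hU h₃ hA i.1 i.2 c))
  map_add' c d := by rw [map_add, map_add, toC_add]
  map_smul' a c := by
    rw [LinearMap.map_smulₛₗ, LinearMap.map_smul, RingHom.id_apply, ← toC_conj_smul]

/-- `conjToC i c`, read back in the tower, is `[conj c]`. -/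
theorem conjToC_apply (hHD : exists_isReal_hodgeModel) (hI : hodgePQ_independent_of_hodgeModel)
    (hU : BallQuotientUniformisedDatum) (h₃ : CMAbelianVarietyRealised) (hA : Arapura2012_Cor_15_4_6) (i : TLvl V) (c : HK hHD hI hU h₃ hA V i) :
    ofC hHD hI hU h₃ hA (conjToC hHD hI hU h₃ hA i c) =
      ofLevel hHD hI hU h₃ hA i.1 i.2 (conjLevel hHD hI hU h₃ hA i.1 i.2 c) := rfl

/-- The lift of the levelwise conjugations to the direct limit, valued in the conjugate copy. -/
def conjLift (hHD : exists_isReal_hodgeModel) (hI : hodgePQ_independent_of_hodgeModel)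
    (hU : BallQuotientUniformisedDatum) (h₃ : CMAbelianVarietyRealised) (hA : Arapura2012_Cor_15_4_6)
    : Tower hHD hI hU h₃ hA V →ₗ[ℂ] CTower hHD hI hU h₃ hA V :=
  Module.DirectLimit.lift ℂ (TLvl V) (HK hHD hI hU h₃ hA V) (towerSystem hHD hI hU h₃ hA V) (conjToC hHD hI hU h₃ hA)
    (fun i j hij c ↦ by
      change toC hHD hI hU h₃ hA (ofLevel hHD hI hU h₃ hA j.1 j.2 (conjLevel hHD hI hU h₃ hA j.1 j.2
          (restrictLevel hHD hI hU h₃ hA (TLvl.le_def.mp hij) i.2 j.2 c))) =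
        toC hHD hI hU h₃ hA (ofLevel hHD hI hU h₃ hA i.1 i.2 (conjLevel hHD hI hU h₃ hA i.1 i.2 c))
      rw [← restrictLevel_conjLevel, ofLevel_restrictLevel])

/-- **`F∞ = conj ⊗ id` ON THE TOWER** `H = colim_K H¹(X_K(ℂ); ℂ)`: the `ℂ`-antilinear map induced by the componentwise
conjugations of the levels. -/
def conjTower (hHD : exists_isReal_hodgeModel) (hI : hodgePQ_independent_of_hodgeModel)
    (hU : BallQuotientUniformisedDatum) (h₃ : CMAbelianVarietyRealised) (hA : Arapura2012_Cor_15_4_6)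
    : Tower hHD hI hU h₃ hA V →ₗ⋆[ℂ] Tower hHD hI hU h₃ hA V where
  toFun x := ofC hHD hI hU h₃ hA (conjLift hHD hI hU h₃ hA x)
  map_add' x y := by rw [map_add, ofC_add]
  map_smul' a x := by rw [LinearMap.map_smul, ofC_smul]

/-- **On level `K`, `F∞ [c] = [conj c]`.** -/
@[simp] theorem conjTower_ofLevel (hHD : exists_isReal_hodgeModel) (hI : hodgePQ_independent_of_hodgeModel)
    (hU : BallQuotientUniformisedDatum) (h₃ : CMAbelianVarietyRealised) (hA : Arapura2012_Cor_15_4_6)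
    (Γ : Level V) (hΓ : Γ.BelowConjThree) (c : towerLevel hHD hI hU h₃ hA Γ hΓ) :
    conjTower hHD hI hU h₃ hA (ofLevel hHD hI hU h₃ hA Γ hΓ c) =
      ofLevel hHD hI hU h₃ hA Γ hΓ (conjLevel hHD hI hU h₃ hA Γ hΓ c) := by
  change ofC hHD hI hU h₃ hA (conjLift hHD hI hU h₃ hA (ofLevel hHD hI hU h₃ hA Γ hΓ c)) = _
  rw [conjLift, Module.DirectLimit.lift_of]
  rfl

/-- `F∞` is an involution. -/
@[simp] theorem conjTower_conjTower (hHD : exists_isReal_hodgeModel) (hI : hodgePQ_independent_of_hodgeModel)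
    (hU : BallQuotientUniformisedDatum) (h₃ : CMAbelianVarietyRealised) (hA : Arapura2012_Cor_15_4_6) (x : Tower hHD hI hU h₃ hA V) :
    conjTower hHD hI hU h₃ hA (conjTower hHD hI hU h₃ hA x) = x := by
  obtain ⟨Γ, hΓ, c, rfl⟩ := exists_ofLevel hHD hI hU h₃ hA x
  rw [conjTower_ofLevel, conjTower_ofLevel, conjLevel_conjLevel]

/-- **`F∞` as an antilinear automorphism of the tower.** -/
def conjTowerEquiv (hHD : exists_isReal_hodgeModel) (hI : hodgePQ_independent_of_hodgeModel)
    (hU : BallQuotientUniformisedDatum) (h₃ : CMAbelianVarietyRealised) (hA : Arapura2012_Cor_15_4_6)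
    : Tower hHD hI hU h₃ hA V ≃ₗ⋆[ℂ] Tower hHD hI hU h₃ hA V :=
  { conjTower hHD hI hU h₃ hA with
    invFun := conjTower hHD hI hU h₃ hA
    left_inv := conjTower_conjTower hHD hI hU h₃ hA
    right_inv := conjTower_conjTower hHD hI hU h₃ hA }

/-- The equivalence is `conjTower`. -/
@[simp] theorem conjTowerEquiv_apply (hHD : exists_isReal_hodgeModel) (hI : hodgePQ_independent_of_hodgeModel)
    (hU : BallQuotientUniformisedDatum) (h₃ : CMAbelianVarietyRealised) (hA : Arapura2012_Cor_15_4_6) (x : Tower hHD hI hU h₃ hA V) :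
    conjTowerEquiv hHD hI hU h₃ hA x = conjTower hHD hI hU h₃ hA x := rfl

/-- Its inverse is `conjTower` again. -/
@[simp] theorem conjTowerEquiv_symm_apply (hHD : exists_isReal_hodgeModel) (hI : hodgePQ_independent_of_hodgeModel)
    (hU : BallQuotientUniformisedDatum) (h₃ : CMAbelianVarietyRealised) (hA : Arapura2012_Cor_15_4_6) (x : Tower hHD hI hU h₃ hA V) :
    (conjTowerEquiv hHD hI hU h₃ hA).symm x = conjTower hHD hI hU h₃ hA x := rfl

/-- `F∞` is injective. -/
theorem conjTower_injective (hHD : exists_isReal_hodgeModel) (hI : hodgePQ_independent_of_hodgeModel)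
    (hU : BallQuotientUniformisedDatum) (h₃ : CMAbelianVarietyRealised) (hA : Arapura2012_Cor_15_4_6)
    : Injective (conjTower hHD hI hU h₃ hA (V := V)) :=
  (conjTowerEquiv hHD hI hU h₃ hA).injective

/-! ## 3. Equivariance under `U(V)(𝔸_f)` and the fixed vectors -/

/-- **`F∞` is `U(V)(𝔸_f)`-EQUIVARIANT**: `act g ∘ F∞ = F∞ ∘ act g`. -/
theorem act_conjTower (hHD : exists_isReal_hodgeModel) (hI : hodgePQ_independent_of_hodgeModel)
    (hU : BallQuotientUniformisedDatum) (h₃ : CMAbelianVarietyRealised) (hA : Arapura2012_Cor_15_4_6)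
    (g : V.adelicFin) (x : Tower hHD hI hU h₃ hA V) :
    act hHD hI hU h₃ hA g (conjTower hHD hI hU h₃ hA x) = conjTower hHD hI hU h₃ hA (act hHD hI hU h₃ hA g x) := by
  obtain ⟨Γ, hΓ, c, rfl⟩ := exists_ofLevel hHD hI hU h₃ hA x
  rw [conjTower_ofLevel, act_ofLevel, act_ofLevel, conjTower_ofLevel, translate_conjLevel]

/-- Equivariance, module form: `F∞ (of g • x) = of g • F∞ x`. -/
theorem conjTower_of_smul (hHD : exists_isReal_hodgeModel) (hI : hodgePQ_independent_of_hodgeModel)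
    (hU : BallQuotientUniformisedDatum) (h₃ : CMAbelianVarietyRealised) (hA : Arapura2012_Cor_15_4_6)
    (g : V.adelicFin) (x : Tower hHD hI hU h₃ hA V) :
    conjTower hHD hI hU h₃ hA (MonoidAlgebra.of ℂ ↥V.adelicFin g • x) =
      MonoidAlgebra.of ℂ ↥V.adelicFin g • conjTower hHD hI hU h₃ hA x := by
  rw [of_smul_eq_act, of_smul_eq_act, act_conjTower]

/-- **`F∞` preserves the `K`-fixed vectors**: `F∞ x ∈ H^K ↔ x ∈ H^K`. -/
theorem conjTower_mem_fixedBy_iff (hHD : exists_isReal_hodgeModel) (hI : hodgePQ_independent_of_hodgeModel)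
    (hU : BallQuotientUniformisedDatum) (h₃ : CMAbelianVarietyRealised) (hA : Arapura2012_Cor_15_4_6)
    (K : Subgroup ↥V.adelicFin) (x : Tower hHD hI hU h₃ hA V) :
    conjTower hHD hI hU h₃ hA x ∈ fixedBy K (Tower hHD hI hU h₃ hA V) ↔ x ∈ fixedBy K (Tower hHD hI hU h₃ hA V) := by
  simp only [mem_fixedBy, ← conjTower_of_smul]
  exact forall₂_congr fun k _ ↦ (conjTower_injective hHD hI hU h₃ hA).eq_iff

/-- `F∞` maps `fixedBy K` onto `fixedBy K`. -/
theorem map_conjTowerEquiv_fixedBy (hHD : exists_isReal_hodgeModel) (hI : hodgePQ_independent_of_hodgeModel)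
    (hU : BallQuotientUniformisedDatum) (h₃ : CMAbelianVarietyRealised) (hA : Arapura2012_Cor_15_4_6) (K : Subgroup ↥V.adelicFin) :
    (fixedBy K (Tower hHD hI hU h₃ hA V)).map (conjTowerEquiv hHD hI hU h₃ hA).toLinearMap =
      fixedBy K (Tower hHD hI hU h₃ hA V) := by
  ext x
  constructor
  · rintro ⟨y, hy, rfl⟩
    exact (conjTower_mem_fixedBy_iff hHD hI hU h₃ hA K y).mpr hy
  · intro hx
    exact ⟨conjTower hHD hI hU h₃ hA x, (conjTower_mem_fixedBy_iff hHD hI hU h₃ hA K x).mpr hx,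
      conjTower_conjTower hHD hI hU h₃ hA x⟩

/-- `F∞` preserves the image of `H_K`. -/
theorem conjTower_mem_levelImage (hHD : exists_isReal_hodgeModel) (hI : hodgePQ_independent_of_hodgeModel)
    (hU : BallQuotientUniformisedDatum) (h₃ : CMAbelianVarietyRealised) (hA : Arapura2012_Cor_15_4_6)
    {Γ : Level V} (hΓ : Γ.BelowConjThree) {x : Tower hHD hI hU h₃ hA V}
    (hx : x ∈ levelImage hHD hI hU h₃ hA Γ hΓ) : conjTower hHD hI hU h₃ hA x ∈ levelImage hHD hI hU h₃ hA Γ hΓ := by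
  obtain ⟨c, rfl⟩ := hx
  exact ⟨conjLevel hHD hI hU h₃ hA Γ hΓ c, (conjTower_ofLevel hHD hI hU h₃ hA Γ hΓ c).symm⟩


/-- `F∞` maps the image of `H_K` onto itself. -/
theorem map_conjTowerEquiv_levelImage (hHD : exists_isReal_hodgeModel) (hI : hodgePQ_independent_of_hodgeModel)
    (hU : BallQuotientUniformisedDatum) (h₃ : CMAbelianVarietyRealised) (hA : Arapura2012_Cor_15_4_6)
    (Γ : Level V) (hΓ : Γ.BelowConjThree) :
    (levelImage hHD hI hU h₃ hA Γ hΓ).map (conjTowerEquiv hHD hI hU h₃ hA).toLinearMap = levelImage hHD hI hU h₃ hA Γ hΓ := by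
  ext x
  constructor
  · rintro ⟨y, hy, rfl⟩
    exact conjTower_mem_levelImage hHD hI hU h₃ hA hΓ hy
  · intro hx
    exact ⟨conjTower hHD hI hU h₃ hA x, conjTower_mem_levelImage hHD hI hU h₃ hA hΓ hx,
      conjTower_conjTower hHD hI hU h₃ hA x⟩

/-! ## 4. The identity-component restriction intertwines `F∞` with `conj ⊗ id` on fixed vectors -/

/-- On the image of `H_K`: `res Γ (F∞ [c]) = conj (res Γ [c])`. -/
theorem res_conjTower_ofLevel (hHD : exists_isReal_hodgeModel) (hI : hodgePQ_independent_of_hodgeModel)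
    (hU : BallQuotientUniformisedDatum) (h₃ : CMAbelianVarietyRealised) (hA : Arapura2012_Cor_15_4_6)
    (Γ : Level V) (hΓ : Γ.BelowConjThree) (c : towerLevel hHD hI hU h₃ hA Γ hΓ) :
    TowerCarrier.res hHD hI hU h₃ hA Γ hΓ (conjTower hHD hI hU h₃ hA (ofLevel hHD hI hU h₃ hA Γ hΓ c)) =
      HodgeStructure.conj (TowerCarrier.res hHD hI hU h₃ hA Γ hΓ (ofLevel hHD hI hU h₃ hA Γ hΓ c)) := by
  rw [conjTower_ofLevel, res_ofLevel, res_ofLevel, res_conjLevel]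

/-- **`resTotal Γ (F∞ x) = conj (resTotal Γ x)` for every `Γ.K`-fixed `x`** (for `Γ` below a conjugate of `K_f(3)` by
`fixedBy Γ.K H = H_K`; for other `Γ`, `resTotal Γ = 0`). -/
theorem resTotal_conjTower_of_mem_fixedBy (hHD : exists_isReal_hodgeModel) (hI : hodgePQ_independent_of_hodgeModel)
    (hU : BallQuotientUniformisedDatum) (h₃ : CMAbelianVarietyRealised) (hA : Arapura2012_Cor_15_4_6) (Γ : Level V) {x : Tower hHD hI hU h₃ hA V}
    (hx : x ∈ fixedBy Γ.K (Tower hHD hI hU h₃ hA V)) :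
    resTotal hHD hI hU h₃ hA Γ (conjTower hHD hI hU h₃ hA x) = HodgeStructure.conj (resTotal hHD hI hU h₃ hA Γ x) := by
  by_cases hΓ : Γ.BelowConjThree
  · rw [fixedBy_eq_levelImage hHD hI hU h₃ hA Γ hΓ] at hx
    obtain ⟨c, rfl⟩ := hx
    rw [resTotal_of hHD hI hU h₃ hA Γ hΓ, res_conjTower_ofLevel]
  · rw [resTotal, dif_neg hΓ, LinearMap.zero_apply, LinearMap.zero_apply, map_zero]

/-- The same with the fixed-vector hypothesis on `F∞ x`. -/
theorem resTotal_conjTower_of_conjTower_mem_fixedBy (hHD : exists_isReal_hodgeModel) (hI : hodgePQ_independent_of_hodgeModel)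
    (hU : BallQuotientUniformisedDatum) (h₃ : CMAbelianVarietyRealised) (hA : Arapura2012_Cor_15_4_6) (Γ : Level V) {x : Tower hHD hI hU h₃ hA V}
    (hx : conjTower hHD hI hU h₃ hA x ∈ fixedBy Γ.K (Tower hHD hI hU h₃ hA V)) :
    resTotal hHD hI hU h₃ hA Γ (conjTower hHD hI hU h₃ hA x) = HodgeStructure.conj (resTotal hHD hI hU h₃ hA Γ x) :=
  resTotal_conjTower_of_mem_fixedBy hHD hI hU h₃ hA Γ ((conjTower_mem_fixedBy_iff hHD hI hU h₃ hA Γ.K x).mp hx)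


/-- **Level-family form of the `res`-law** (the socket shape of `D2Bridge/Thm418CConjTransportTower`): for a family `c ∈ H_K`,
`resTotal K (F∞ [c]) = conj (resTotal K [c])`. -/
theorem resTotal_conjTower_ofLevel (hHD : exists_isReal_hodgeModel) (hI : hodgePQ_independent_of_hodgeModel)
    (hU : BallQuotientUniformisedDatum) (h₃ : CMAbelianVarietyRealised) (hA : Arapura2012_Cor_15_4_6)
    (Γ : Level V) (hΓ : Γ.BelowConjThree) (c : towerLevel hHD hI hU h₃ hA Γ hΓ) :
    resTotal hHD hI hU h₃ hA Γ (conjTower hHD hI hU h₃ hA (ofLevel hHD hI hU h₃ hA Γ hΓ c)) =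
      HodgeStructure.conj (resTotal hHD hI hU h₃ hA Γ (ofLevel hHD hI hU h₃ hA Γ hΓ c)) := by
  rw [conjTower_ofLevel, resTotal_ofLevel, resTotal_ofLevel, res_conjLevel]

/-- The same for the equivalence `conjTowerEquiv`. -/
theorem resTotal_conjTowerEquiv_ofLevel (hHD : exists_isReal_hodgeModel) (hI : hodgePQ_independent_of_hodgeModel)
    (hU : BallQuotientUniformisedDatum) (h₃ : CMAbelianVarietyRealised) (hA : Arapura2012_Cor_15_4_6)
    (Γ : Level V) (hΓ : Γ.BelowConjThree) (c : towerLevel hHD hI hU h₃ hA Γ hΓ) :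
    resTotal hHD hI hU h₃ hA Γ (conjTowerEquiv hHD hI hU h₃ hA (ofLevel hHD hI hU h₃ hA Γ hΓ c)) =
      HodgeStructure.conj (resTotal hHD hI hU h₃ hA Γ (ofLevel hHD hI hU h₃ hA Γ hΓ c)) :=
  resTotal_conjTower_ofLevel hHD hI hU h₃ hA Γ hΓ c

/-- `U(V)(𝔸_f)`-equivariance of the equivalence, in the socket's orientation: `F (act g x) = act g (F x)`. -/
theorem conjTowerEquiv_act (hHD : exists_isReal_hodgeModel) (hI : hodgePQ_independent_of_hodgeModel)
    (hU : BallQuotientUniformisedDatum) (h₃ : CMAbelianVarietyRealised) (hA : Arapura2012_Cor_15_4_6)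
    (g : V.adelicFin) (x : Tower hHD hI hU h₃ hA V) :
    conjTowerEquiv hHD hI hU h₃ hA (act hHD hI hU h₃ hA g x) = act hHD hI hU h₃ hA g (conjTowerEquiv hHD hI hU h₃ hA x) :=
  (act_conjTower hHD hI hU h₃ hA g x).symm

end Tower

end Summit.HodgeConjecture.CorCM.D2Bridge.TowerConj

end
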